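import Mathlib
import HarnessLib
import Literature.MathematicalPhysics.QuantumFieldTheory.YangMillsOS
import Literature.MathematicalPhysics.QuantumFieldTheory.SpeciesTimeReflection
import Literature.MathematicalPhysics.QuantumFieldTheory.WilsonAxisSymmetry
import Summits.QuantumFields.YangMills.Theorems.ParabolicTrajectoryLatticeGapOnTrajectoryStubNegReflectRP
import Summits.QuantumFields.YangMills.Theorems.FradkinShenkerFlowFiniteSusceptibilityWeakCouplingRPCauchySchwarz
import Summits.QuantumFields.YangMills.Theorems.PencilRigidityCurvatureKernelBoundLatticeWindowPairOfOne

/-!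
# `CurvatureKernelBound` (stmt-QuantumFields-11687), line `sixteen-charts-analytic-kernel`, skeleton v13 — stub `OddTorusCovCauchySchwarz`

Crux declaration: `Summit.QuantumFields.YangMills.Theses.PencilRigidity.CurvatureKernelBound`.

**What is proved (stub F of the lead's skeleton v13).** Osterwalder–Seiler SITE-reflection
positivity of Wilson's lattice gauge measure `μ = wilsonMeasure ρ β` on the ODD torus `(ℤ/(2S+1))⁴`
(`β ≥ 0`, `S ≥ 1`, continuous `ρ`), in centred form: for two real bounded measurable observables
`F, H` depending only on the links of the closed positive half of the site reflection
`Θ' = GaugeConfig.negReflect` (`t ↦ −t`; base time `≤ S`, and `< S` for temporal links), the form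
`CovΘ(X, Y) = ∫ X(Θ'U) Y(U) dμ − (∫ X dμ)(∫ Y dμ)` satisfies
`0 ≤ CovΘ(F, F)`, `0 ≤ CovΘ(H, H)` and `CovΘ(F, H)² ≤ CovΘ(F, F) · CovΘ(H, H)`.

**Proof.** The tree's abstract centred Cauchy–Schwarz
`FiniteSusceptibilityWeakCoupling.RPCauchySchwarz.covariance_rp_cauchySchwarz` (a measurable
measure-preserving involution `Θ` and a cone `D` closed under `X + tY`, `X − c` on whose bounded
measurable members `∫ X(Θω) X(ω) dμ ≥ 0`) is instantiated with `Θ := GaugeConfig.negReflect`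
(measurable: `WilsonSiteRP.measurable_negReflect`; measure preserving on every torus:
`wilsonMeasure_map_negReflect_eq`; involutive: `WilsonSiteRP.negReflect_negReflect_config`) and
`D := DependsOn · {positive links}`; the uncentred positivity on `D` is the real form
(`oddTorusCov_integral_negReflect_mul_self_nonneg`) of the tree's
`OrbitKantorovichFiniteSize.wilsonExpectation_negReflect_nonneg_odd`. Finally
`ProbabilityTheory.covariance_eq_sub` and `∫ X(Θ'U) dμ = ∫ X dμ` (`integral_comp_negReflect_eq`)
turn `cov[X ∘ Θ', Y; μ]` into the registered explicit expression
(`oddTorusCov_covariance_negReflect_eq`).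

References: K. Osterwalder, E. Seiler, Ann. Phys. 110 (1978) 440, §2; E. Seiler, LNP 159 (1982) Ch. 2.
-/

noncomputable section

open scoped BigOperators Topology ComplexConjugate
open Filter Set Function TopologicalSpace MeasureTheory
open Literature.MathematicalPhysics.QuantumLattice Literature.MathematicalPhysics.AQFT Literature.MathematicalPhysics.QuantumFieldTheory

namespace Summit.QuantumFields.YangMills.Theorems.CurvatureKernel

section Helpers

variable {G : Type*} [Group G] [TopologicalSpace G] [IsTopologicalGroup G] [CompactSpace G]
  [MeasurableSpace G] [BorelSpace G] {N : ℕ} (ρ : G →* Matrix (Fin N) (Fin N) ℂ)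

open scoped ComplexOrder in
/-- **Uncentred site-reflection positivity of the odd Wilson torus, real form.** For continuous `ρ`,
`β ≥ 0`, `S ≥ 1` and a real bounded measurable `X` on `GaugeConfig 4 (2S+1) G` depending only on the
`Θ'`-positive links (base time `≤ S`, and `< S` for temporal links), `0 ≤ ∫ X(Θ'U) X(U) dμ_{Λ,β}`,
`Θ' = GaugeConfig.negReflect`. The tree's complex statement
`OrbitKantorovichFiniteSize.wilsonExpectation_negReflect_nonneg_odd` applied to `U ↦ (X U : ℂ)`.
[cite: OsterwalderSeiler1978, §2] -/
theorem oddTorusCov_integral_negReflect_mul_self_nonneg (hρ : Continuous ρ) {β : ℝ} (hβ : 0 ≤ β)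
    {S : ℕ} (hS : 1 ≤ S) (X : GaugeConfig 4 (2 * S + 1) G → ℝ) (hX : Measurable X)
    (hXb : ∃ C : ℝ, ∀ U, |X U| ≤ C)
    (hXD : DependsOn X {e : Edge 4 (2 * S + 1) | (e.1 0).val ≤ S ∧ (e.2 = 0 → (e.1 0).val < S)}) :
    0 ≤ ∫ U, X U.negReflect * X U ∂(wilsonMeasure ρ β) := by
  obtain ⟨C, hC⟩ := hXb
  have hXc : Measurable fun U : GaugeConfig 4 (2 * S + 1) G => (X U : ℂ) :=
    Complex.measurable_ofReal.comp hX
  have hXcb : ∃ C : ℝ, ∀ U : GaugeConfig 4 (2 * S + 1) G, ‖(X U : ℂ)‖ ≤ C :=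
    ⟨C, fun U => by rw [Complex.norm_real, Real.norm_eq_abs]; exact hC U⟩
  have hXcD : DependsOn (fun U : GaugeConfig 4 (2 * S + 1) G => (X U : ℂ))
      {e : Edge 4 (2 * S + 1) | (e.1 0).val ≤ S ∧ (e.2 = 0 → (e.1 0).val < S)} :=
    fun U V hUV => by
      show (X U : ℂ) = X V
      rw [hXD hUV]
  have h := Summit.QuantumFields.YangMills.Cruxes.LatticeGapOnTrajectory.OrbitKantorovichFiniteSize.wilsonExpectation_negReflect_nonneg_odd
    ρ hρ hβ hS (fun U => (X U : ℂ)) hXc hXcb hXcD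
  unfold wilsonExpectation at h
  have hint : (∫ U, conj ((X U.negReflect : ℝ) : ℂ) * (X U : ℂ)
      ∂(wilsonMeasure ρ β : MeasureTheory.Measure (GaugeConfig 4 (2 * S + 1) G))) =
        ((∫ U, X U.negReflect * X U
          ∂(wilsonMeasure ρ β : MeasureTheory.Measure (GaugeConfig 4 (2 * S + 1) G)) : ℝ) : ℂ) := by
    rw [← integral_complex_ofReal]
    refine integral_congr_ae (ae_of_all _ fun U => ?_)
    simp only [Complex.conj_ofReal, Complex.ofReal_mul]
  rw [hint] at h
  exact Complex.zero_le_real.1 h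

/-- The covariance against a `Θ'`-reflected observable in explicit form: for real bounded measurable
`X, Y` on any torus, `cov[X ∘ Θ', Y; μ_{Λ,β}] = ∫ X(Θ'U) Y(U) dμ − (∫ X dμ)(∫ Y dμ)`
(`ProbabilityTheory.covariance_eq_sub` for the probability measure `μ_{Λ,β} = wilsonMeasure ρ β`, and
`∫ X(Θ'U) dμ = ∫ X dμ` by `Θ'`-invariance, `integral_comp_negReflect_eq`). [folklore] -/
theorem oddTorusCov_covariance_negReflect_eq {d L : ℕ} [NeZero d] [NeZero L] (hρ : Continuous ρ)
    (β : ℝ) {X Y : GaugeConfig d L G → ℝ} (hX : Measurable X) (hY : Measurable Y)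
    (hXb : ∃ C : ℝ, ∀ U, |X U| ≤ C) (hYb : ∃ C : ℝ, ∀ U, |Y U| ≤ C) :
    ProbabilityTheory.covariance (fun U => X U.negReflect) Y (wilsonMeasure ρ β) =
      (∫ U, X U.negReflect * Y U ∂(wilsonMeasure ρ β)) -
        (∫ U, X U ∂(wilsonMeasure ρ β)) * (∫ U, Y U ∂(wilsonMeasure ρ β)) := by
  haveI := isProbabilityMeasure_wilsonMeasure (d := d) (L := L) ρ hρ β
  obtain ⟨CX, hCX⟩ := hXb
  obtain ⟨CY, hCY⟩ := hYb
  have lX : MemLp (fun U : GaugeConfig d L G => X U.negReflect) 2 (wilsonMeasure ρ β) :=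
    MemLp.of_bound (hX.comp WilsonSiteRP.measurable_negReflect).aestronglyMeasurable CX
      (ae_of_all _ fun U => by simpa [Real.norm_eq_abs] using hCX U.negReflect)
  have lY : MemLp Y 2 (wilsonMeasure ρ β) :=
    MemLp.of_bound hY.aestronglyMeasurable CY
      (ae_of_all _ fun U => by simpa [Real.norm_eq_abs] using hCY U)
  rw [ProbabilityTheory.covariance_eq_sub lX lY, integral_comp_negReflect_eq ρ hρ β X]
  rfl

end Helpers

/-- **Stub F (`OddTorusCovCauchySchwarz`) of line `sixteen-charts-analytic-kernel`, skeleton v13, for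
crux `stmt-QuantumFields-11687`.** Osterwalder–Seiler site-reflection positivity of Wilson's lattice
gauge measure `μ = wilsonMeasure ρ β` on the odd torus `(ℤ/(2S+1))⁴` (`β ≥ 0`, `S ≥ 1`, continuous
`ρ`), centred form: for real bounded measurable `F, H` depending only on the links of the closed
positive half of `Θ' = GaugeConfig.negReflect` (base time `≤ S`, and `< S` for temporal links), with
`CovΘ(X, Y) = ∫ X(Θ'U) Y(U) dμ − (∫ X dμ)(∫ Y dμ)`:
`0 ≤ CovΘ(F, F)`, `0 ≤ CovΘ(H, H)`, `CovΘ(F, H)² ≤ CovΘ(F, F) · CovΘ(H, H)`.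
Proof: the abstract `RPCauchySchwarz.covariance_rp_cauchySchwarz` for the measure-preserving
involution `Θ'` (`wilsonMeasure_map_negReflect_eq`, `negReflect_negReflect_config`) and the cone
`DependsOn · {positive links}`, fed with the uncentred positivity
`wilsonExpectation_negReflect_nonneg_odd`; then `covariance_eq_sub` and `Θ'`-invariance of the mean.
[cite: OsterwalderSeiler1978, §2] -/
theorem OddTorusCovCauchySchwarz : open Literature.MathematicalPhysics.QuantumLattice Literature.MathematicalPhysics.AQFT Literature.MathematicalPhysics.QuantumFieldTheory in ∀ (G : Type) [Group G] [TopologicalSpace G] [IsTopologicalGroup G] [CompactSpace G] [MeasurableSpace G] [BorelSpace G] (N : ℕ) (ρ : G →* Matrix (Fin N) (Fin N) ℂ), Continuous ρ → ∀ (β : ℝ), 0 ≤ β → ∀ (S : ℕ), 1 ≤ S → ∀ (F H : GaugeConfig 4 (2 * S + 1) G → ℝ), Measurable F → Measurable H → (∃ C : ℝ, ∀ U, |F U| ≤ C) → (∃ C : ℝ, ∀ U, |H U| ≤ C) → DependsOn F {e : Edge 4 (2 * S + 1) | (e.1 0).val ≤ S ∧ (e.2 = 0 → (e.1 0).val < S)}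 → DependsOn H {e : Edge 4 (2 * S + 1) | (e.1 0).val ≤ S ∧ (e.2 = 0 → (e.1 0).val < S)} → 0 ≤ ((∫ U, F U.negReflect * F U ∂(wilsonMeasure ρ β : MeasureTheory.Measure (GaugeConfig 4 (2 * S + 1) G))) - (∫ U, F U ∂(wilsonMeasure ρ β : MeasureTheory.Measure (GaugeConfig 4 (2 * S + 1) G))) * (∫ U, F U ∂(wilsonMeasure ρ β : MeasureTheory.Measure (GaugeConfig 4 (2 * S + 1) G)))) ∧ 0 ≤ ((∫ U, H U.negReflect * H U ∂(wilsonMeasure ρ β : MeasureTheory.Measure (GaugeConfig 4 (2 * S + 1) G))) - (∫ U, H U ∂(wilsonMeasure ρ β : MeasureTheory.Measure (GaugeConfig 4 (2 * S + 1) G))) * (∫ U, H U ∂(wilsonMeasure ρ β : MeasureTheory.Measure (GaugeConfig 4 (2 * S + 1) G)))) ∧ ((∫ U, F U.negReflect * H U ∂(wilsonMeasure ρ β : MeasureTheory.Measure (GaugeConfig 4 (2 * S + 1) G))) - (∫ U, F U ∂(wilsonMeasure ρ β : MeasureTheory.Measure (GaugeConfig 4 (2 * S + 1) G))) * (∫ U,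 H U ∂(wilsonMeasure ρ β : MeasureTheory.Measure (GaugeConfig 4 (2 * S + 1) G)))) ^ 2 ≤ ((∫ U, F U.negReflect * F U ∂(wilsonMeasure ρ β : MeasureTheory.Measure (GaugeConfig 4 (2 * S + 1) G))) - (∫ U, F U ∂(wilsonMeasure ρ β : MeasureTheory.Measure (GaugeConfig 4 (2 * S + 1) G))) * (∫ U, F U ∂(wilsonMeasure ρ β : MeasureTheory.Measure (GaugeConfig 4 (2 * S + 1) G)))) * ((∫ U, H U.negReflect * H U ∂(wilsonMeasure ρ β : MeasureTheory.Measure (GaugeConfig 4 (2 * S + 1) G))) - (∫ U, H U ∂(wilsonMeasure ρ β : MeasureTheory.Measure (GaugeConfig 4 (2 * S + 1) G))) * (∫ U, H U ∂(wilsonMeasure ρ β : MeasureTheory.Measure (GaugeConfig 4 (2 * S + 1) G)))) := by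
  intro G _ _ _ _ _ _ N ρ hρ β hβ S hS F H hF hH hFb hHb hFD hHD
  haveI : IsProbabilityMeasure
      (wilsonMeasure ρ β : MeasureTheory.Measure (GaugeConfig 4 (2 * S + 1) G)) :=
    isProbabilityMeasure_wilsonMeasure (d := 4) (L := 2 * S + 1) ρ hρ β
  have key :=
    Summit.QuantumFields.YangMills.Theorems.FiniteSusceptibilityWeakCoupling.RPCauchySchwarz.covariance_rp_cauchySchwarz
      (μ := (wilsonMeasure ρ β : MeasureTheory.Measure (GaugeConfig 4 (2 * S + 1) G)))
      (Θ := GaugeConfig.negReflect)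
      (D := fun X : GaugeConfig 4 (2 * S + 1) G → ℝ =>
        DependsOn X {e : Edge 4 (2 * S + 1) | (e.1 0).val ≤ S ∧ (e.2 = 0 → (e.1 0).val < S)})
      WilsonSiteRP.measurable_negReflect (wilsonMeasure_map_negReflect_eq ρ hρ β)
      WilsonSiteRP.negReflect_negReflect_config
      (fun X hX hXb hXD => oddTorusCov_integral_negReflect_mul_self_nonneg ρ hρ hβ hS X hX hXb hXD)
      (fun X Y t hX hY =>
        Summit.QuantumFields.YangMills.Theorems.FiniteSusceptibilityWeakCoupling.RPCauchySchwarz.dependsOn_add_mul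
          hX hY t)
      (fun X c hX =>
        Summit.QuantumFields.YangMills.Theorems.FiniteSusceptibilityWeakCoupling.RPCauchySchwarz.dependsOn_sub_const
          hX c)
      hF hH hFb hHb hFD hHD
  rw [oddTorusCov_covariance_negReflect_eq ρ hρ β hF hF hFb hFb,
    oddTorusCov_covariance_negReflect_eq ρ hρ β hH hH hHb hHb,
    oddTorusCov_covariance_negReflect_eq ρ hρ β hF hH hFb hHb] at key
  exact key

end Summit.QuantumFields.YangMills.Theorems.CurvatureKernel

end
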